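import Summits.HodgeConjecture.HodgeConjecture.Theorems.Ring2AbelianAllWeilHyperbolicDescent
import HarnessLib

/-!
# Ring 2 · AbelianAll (ab-weil-1, gen 5), part B — the hyperbolic and non-split RUNGS re-indexed by
  squarefree discriminant, modulo one print fact; the refereed sixfold columns up the squares

research route, not a corollary; conditional on HC_CM plus one named minimal statement.
Cell line: research route conditional on HC_CM; not a corollary; Q11.4-sentence-2 already refuted in dim ≥ 3.
`HC_CM` (`Theses.RankFourFaces.CMAbelianHodge`) does not occur in this file. No case of the Hodge
conjecture is claimed: every rung statement below is an IMPLICATION or EQUIVALENCE between open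
statements, unconditionally or under the typed print obligation `HyperplanePullbackAlongIsogeny` of
part A (a HYPOTHESIS, never asserted).

* the hyperbolic rungs of `WeilTypeLadder` are conjunctions of slices:
  `splitEightfolds_iff_forall_splitHyperplane`, `splitWeilAbelianVarieties_iff_forall_splitHyperplane`,
  `nonsplitSixfolds_iff_forall_nonsplitHyperplane` (the non-split slice `WeilAlgebraicNonsplitHyperplane n d`
  is defined here; a `Prop`, not an assertion);
* re-indexed, modulo the print obligation: `splitEightfolds_iff_squarefree`,
  `splitWeilAbelianVarieties_iff_squarefree`, `markmanHyperbolicSixfold_iff_squarefree`,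
  `nonsplitSixfolds_iff_squarefree` — each rung `↔` its SQUAREFREE slices (`d = b²a`: the slice at `a`
  gives the slice at `d`); the obligation-free halves `weilAlgebraicNonsplitHyperplane_of_sq_mul`
  (and part A's `weilAlgebraicSplitHyperplane_of_sq_mul`);
* the NON-SPLIT transport `weilAlgebraicNonsplitHyperplane_sq_mul`: the descended `(B, ψ, d)` of a
  non-split `(A, φ', m²d)` is non-split, because a hyperbolic symmetrised hyperplane class of `B` would
  transport along `p : A → B` (part A, `isHyperbolicWeilType_iff_of_isIsogeny`) to one of `A`;
* the two REFEREED sixfold columns on the split slices: Koike 2004 = the slice `(3, 1)`, Schoen 1998 = the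
  slice `(3, 3)` (by-name hypotheses), whence — modulo the print obligation — the slices `(3, m²)` and
  `(3, 3m²)` (`weilAlgebraicSplitHyperplane_three_sq_of_koike2004`, `…_three_sq_mul_three_of_schoen1998`);
* on-path: every slice is a case of the summit (`…_of_hodgeConjecture`).

## References
* B. van Geemen, *An introduction to the Hodge conjecture for abelian varieties*, LNM 1594 (1994),
  Lemma 5.2 (2)–(3), 5.4. [vanGeemen1994HodgeAV]
* D. Mumford, *Abelian Varieties* (1970), §7 Thm. 4 p. 72, §19 Thm. 3. [MumfordAV1970]
* B. Moonen, Yu. Zarhin, *Weil classes on abelian varieties*, Crelle 496 (1998), §1. [MoonenZarhin1998WeilClasses]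
* K. Koike, *Algebraicity of some Weil Hodge classes*, Canad. Math. Bull. 47 (2004), Thm. 2.1, Cor. 2.1,
  Rem. 2.1. [Koike2004WeilHodge]
* C. Schoen, *Addendum to: Hodge classes on self-products of a variety with an automorphism*,
  Compositio Math. 114 (1998), Theorem p. 329, §§10–13. [Schoen1998HodgeWeilAddendum]
* E. Markman, arXiv:2502.03415 (2025; preprint, UNREFEREED), §1.1–1.2, Thm. 1.5.1. [Markman2025SecantWeil]
* E. Markman, arXiv:2509.23403 (2025; survey), §11.5, §12. [Markman2025SurveySecant]
-/

noncomputable section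

set_option linter.dupNamespace false

open CategoryTheory
open Literature.AlgebraicGeometry Literature.AlgebraicGeometry.Motives
open Literature.AlgebraicGeometry.HodgeTheory
open Literature.AlgebraicTopology.SingularHomology
open Summit.HodgeConjecture.HodgeConjecture.Cruxes.HodgeAbelianVarieties.EStepSecantInduction
open Summit.HodgeConjecture.HodgeConjecture.WeilTypeLadder

namespace Summit.HodgeConjecture.HodgeConjecture.Ring2.AbelianAll

/-! ### The named hyperbolic rungs, re-indexed -/

/-- `SplitEightfolds` is the conjunction of its `d`-slices `WeilAlgebraicSplitHyperplane 4 d` (the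
hypothesis `IsSmoothProjective 8 A.X` of the rung is automatic for abelian varieties). [folklore] -/
theorem splitEightfolds_iff_forall_splitHyperplane :
    SplitEightfolds ↔ ∀ d : ℕ, 0 < d → Stubs.WeilAlgebraicSplitHyperplane 4 d := by
  constructor
  · intro h d hd A φ e a hA hφ ha ha0 hhyp c hw hc h44
    exact h d hd A φ hA (isSmoothProjective_of_dim_eq' hA) hφ e a ha ha0 hhyp c hc h44 hw
  · intro h d hd A φ hA _ hφ e a ha ha0 hhyp c hc h44 hw
    exact h d hd A φ e a hA hφ ha ha0 hhyp c hw hc h44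

/-- `SplitWeilAbelianVarieties` is the conjunction of its `(n, d)`-slices, `n ≥ 4`. [folklore] -/
theorem splitWeilAbelianVarieties_iff_forall_splitHyperplane :
    SplitWeilAbelianVarieties ↔
      ∀ n : ℕ, 4 ≤ n → ∀ d : ℕ, 0 < d → Stubs.WeilAlgebraicSplitHyperplane n d := by
  constructor
  · intro h n hn d hd A φ e a hA hφ ha ha0 hhyp c hw hc hnn
    exact h n hn d hd A φ hA (isSmoothProjective_of_dim_eq' hA) hφ e a ha ha0 hhyp c hc hnn hw
  · intro h n hn d hd A φ hA _ hφ e a ha ha0 hhyp c hc hnn hw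
    exact h n hn d hd A φ e a hA hφ ha ha0 hhyp c hw hc hnn

/-- **R2₈ re-indexed: `SplitEightfolds ↔` its SQUAREFREE slices**, modulo the print obligation.
OPEN on both sides; no case of HC is claimed. [cite: Markman2025SecantWeil, §1.2 and p. 7 after Thm. 1.5.1]
[cite: MoonenZarhin1998WeilClasses, §1] -/
theorem splitEightfolds_iff_squarefree (H : HyperplanePullbackAlongIsogeny) :
    SplitEightfolds ↔ ∀ d : ℕ, 0 < d → Squarefree d → Stubs.WeilAlgebraicSplitHyperplane 4 d := by
  rw [splitEightfolds_iff_forall_splitHyperplane, forall_weilAlgebraicSplitHyperplane_iff_squarefree H]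

/-- **R2 re-indexed: `SplitWeilAbelianVarieties ↔` its squarefree slices** (`n ≥ 4`), modulo the print
obligation. [cite: Markman2025SurveySecant, §12] [cite: MoonenZarhin1998WeilClasses, §1] -/
theorem splitWeilAbelianVarieties_iff_squarefree (H : HyperplanePullbackAlongIsogeny) :
    SplitWeilAbelianVarieties ↔
      ∀ n : ℕ, 4 ≤ n → ∀ d : ℕ, 0 < d → Squarefree d → Stubs.WeilAlgebraicSplitHyperplane n d := by
  rw [splitWeilAbelianVarieties_iff_forall_splitHyperplane]
  exact forall_congr' fun n => forall_congr' fun _ =>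
    forall_weilAlgebraicSplitHyperplane_iff_squarefree H n

/-- **F2 re-indexed: Markman's split-sixfold STATEMENT (`Markman2025_weilClasses_algebraic_hyperbolicSixfold`,
a `def`, preprint arXiv:2502.03415 Thm. 1.5.1, UNREFEREED, never asserted here) `↔` its squarefree slices**,
modulo the print obligation. [cite: Markman2025SecantWeil, Thm. 1.5.1] [cite: MoonenZarhin1998WeilClasses, §1] -/
theorem markmanHyperbolicSixfold_iff_squarefree (H : HyperplanePullbackAlongIsogeny) :
    Markman2025_weilClasses_algebraic_hyperbolicSixfold ↔
      ∀ d : ℕ, 0 < d → Squarefree d → Stubs.WeilAlgebraicSplitHyperplane 3 d := by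
  rw [← Stubs.weilAlgebraicSplitHyperplane_three_iff_markman,
    forall_weilAlgebraicSplitHyperplane_iff_squarefree H]

/-! ### The refereed sixfold columns on the split slices -/

/-- Koike 2004 (refereed; the named fact `Koike2004_weilClasses_algebraic_hyperbolicSixfold_one`, taken as a
hypothesis) IS the split slice at `(3, 1)`. [cite: Koike2004WeilHodge, Thm. 2.1 and Cor. 2.1 (§2)] -/
theorem weilAlgebraicSplitHyperplane_three_one_of_koike2004
    (hK : Koike2004_weilClasses_algebraic_hyperbolicSixfold_one) : Stubs.WeilAlgebraicSplitHyperplane 3 1 := by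
  intro A φ e a hA hφ ha ha0 hhyp c hw hc h33
  exact hK A φ hA (isSmoothProjective_of_dim_eq' hA) hφ e a ha ha0 hhyp c hc h33 hw

/-- Schoen 1998 (refereed; the named fact `Schoen1998_weilClasses_algebraic_hyperbolicSixfold_three`, taken as a
hypothesis) IS the split slice at `(3, 3)`. [cite: Schoen1998HodgeWeilAddendum, §§11–13 and Theorem (p. 329)] -/
theorem weilAlgebraicSplitHyperplane_three_three_of_schoen1998
    (hS : Schoen1998_weilClasses_algebraic_hyperbolicSixfold_three) : Stubs.WeilAlgebraicSplitHyperplane 3 3 := by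
  intro A φ e a hA hφ ha ha0 hhyp c hw hc h33
  exact hS A φ hA (isSmoothProjective_of_dim_eq' hA) hφ e a ha ha0 hhyp c hc h33 hw

/-- **The refereed `ℚ(i)` column propagates up the squares on the SPLIT SIXFOLD slices, modulo the print
obligation**: the slices `(3, m²)`, `d = 1, 4, 9, 16, …` (hyperbolic sixfolds with `K = ℚ(√-m²) = ℚ(i)` and
`φ` scaled by `m`, so that `φ/m ∉ End A` in general) follow from Koike's theorem on the isogenous `B = A/φ(A[m])`.
[cite: Koike2004WeilHodge, Cor. 2.1 and Rem. 2.1] [cite: MumfordAV1970, §7 Thm. 4 p. 72] -/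
theorem weilAlgebraicSplitHyperplane_three_sq_of_koike2004 (H : HyperplanePullbackAlongIsogeny)
    (hK : Koike2004_weilClasses_algebraic_hyperbolicSixfold_one) {m : ℕ} (hm : m ≠ 0) :
    Stubs.WeilAlgebraicSplitHyperplane 3 (m ^ 2) := by
  simpa using weilAlgebraicSplitHyperplane_sq_mul H hm (d := 1)
    (weilAlgebraicSplitHyperplane_three_one_of_koike2004 hK)

/-- **The refereed `ℚ(√-3)` column on the split sixfold slices, modulo the print obligation**: the slices
`(3, 3m²)`, `d = 3, 12, 27, …`. [cite: Schoen1998HodgeWeilAddendum, Theorem (p. 329)] [cite: MumfordAV1970, §7 Thm. 4 p. 72] -/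
theorem weilAlgebraicSplitHyperplane_three_sq_mul_three_of_schoen1998 (H : HyperplanePullbackAlongIsogeny)
    (hS : Schoen1998_weilClasses_algebraic_hyperbolicSixfold_three) {m : ℕ} (hm : m ≠ 0) :
    Stubs.WeilAlgebraicSplitHyperplane 3 (m ^ 2 * 3) :=
  weilAlgebraicSplitHyperplane_sq_mul H hm (weilAlgebraicSplitHyperplane_three_three_of_schoen1998 hS)

/-! ### The non-split slices -/

/-- **The NON-SPLIT slice at `(n, d)`** (generic `n`; at `n = 3` the `d`-slice of R1′ `NonsplitSixfolds`):
for `(A, φ)` of dimension `2n` with `φ² = -d` such that NO `K`-symmetrised hyperplane class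
`d·e^*a + φ^*e^*a` is hyperbolic, the Weil classes of `(A, φ)` in half-dimension `n` are algebraic.
A definition (a `Prop`), not an assertion. [cite: Markman2025SurveySecant, §1.1 and §11.5 Step 1]
[cite: vanGeemen1994HodgeAV, 5.2 and 5.4] -/
def WeilAlgebraicNonsplitHyperplane (n d : ℕ) : Prop :=
  ∀ (A : AbelianVariety ℂ) (φ : A ⟶ A), A.dim = 2 * n → φ ≫ φ = -(d • 𝟙 A) →
    (∀ (e : ProjectiveEmbedding A.X) (a : complexBetti (projectiveSpace e.n ℂ) 2),
      IsRationalClass a → a ≠ 0 →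
        ¬ IsHyperbolicWeilType A φ n ((d : ℂ) • complexBetti.map e.ι 2 a +
          complexBetti.map φ.hom.hom.hom 2 (complexBetti.map e.ι 2 a))) →
      WeilAlgebraicFor n d A φ

/-- `NonsplitSixfolds` is the conjunction of its `d`-slices `WeilAlgebraicNonsplitHyperplane 3 d`. [folklore] -/
theorem nonsplitSixfolds_iff_forall_nonsplitHyperplane :
    NonsplitSixfolds ↔ ∀ d : ℕ, 0 < d → WeilAlgebraicNonsplitHyperplane 3 d := by
  constructor
  · intro h d hd A φ hA hφ hnon c hw hc h33
    exact h d hd A φ hA (isSmoothProjective_of_dim_eq' hA) hφ hnon c hc h33 hw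
  · intro h d hd A φ hA _ hφ hnon c hc h33 hw
    exact h d hd A φ hA hφ hnon c hw hc h33

/-- **DOWNWARD, free: the non-split slice at `(n, m²d)` implies the one at `(n, d)`** (same variety,
`φ ↦ mφ`: a hyperbolic symmetrised hyperplane class for `(mφ, m²d)` is `m²` times one for `(φ, d)`).
[cite: MoonenZarhin1998WeilClasses, §1] [cite: vanGeemen1994HodgeAV, 5.2] -/
theorem weilAlgebraicNonsplitHyperplane_of_sq_mul {n m d : ℕ} (hm : m ≠ 0)
    (hW : WeilAlgebraicNonsplitHyperplane n (m ^ 2 * d)) : WeilAlgebraicNonsplitHyperplane n d := by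
  rcases Nat.eq_zero_or_pos d with rfl | hd
  · simpa using hW
  intro A φ hA hφ hnon c hcW hrat hhodge
  have hφ' : ((m : ℤ) • φ) ≫ ((m : ℤ) • φ) = -((m ^ 2 * d) • 𝟙 A) := by
    rw [Preadditive.zsmul_comp, Preadditive.comp_zsmul, hφ, natCast_zsmul, natCast_zsmul, smul_neg,
      smul_neg, smul_smul, smul_smul, show m * m * d = m ^ 2 * d by ring]
  have hnon' : ∀ (e : ProjectiveEmbedding A.X) (a : complexBetti (projectiveSpace e.n ℂ) 2),
      IsRationalClass a → a ≠ 0 →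
        ¬ IsHyperbolicWeilType A ((m : ℤ) • φ) n (((m ^ 2 * d : ℕ) : ℂ) • complexBetti.map e.ι 2 a +
          complexBetti.map ((m : ℤ) • φ).hom.hom.hom 2 (complexBetti.map e.ι 2 a)) := by
    intro e a ha ha0
    rw [symmetrised_natCast_zsmul,
      isHyperbolicWeilType_smul_iff (pow_ne_zero 2 (Nat.cast_ne_zero.mpr hm)),
      isHyperbolicWeilType_natCast_zsmul_iff hm]
    exact hnon e a ha ha0
  exact hW A ((m : ℤ) • φ) hA hφ' hnon' c (by rwa [weilClassesOf_zsmul_sq_mul hm hd.ne' hφ]) hrat hhodge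

/-- **UPWARD, modulo the print obligation: the non-split slice at `(n, d)` implies the one at
`(n, m²d)`.** Descend `(A, φ', m²d)` to `(B, ψ, d)`; if `(B, ψ)` were hyperbolic for some symmetrised
hyperplane class `d·y' + ψ^*y'` (`y' = e'^*a'`), then `(B, mψ, m²d)` is for `m²d·y' + (mψ)^*y'`, hence
(`isHyperbolicWeilType_comap_of_comm` along `p`, which intertwines `mψ` and `φ'`) `(A, φ')` is for
`m²d·p^*y' + φ'^*p^*y'`, hence for the symmetrised class of the hyperplane class `e''^*a'' = c·p^*y'` of
`A` given by `HyperplanePullbackAlongIsogeny` — contradicting non-splitness of `A`. So `B` is non-split,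
its Weil classes are algebraic by the slice at `(n, d)`, and `weilAlgebraicFor_of_descent` concludes.
[cite: vanGeemen1994HodgeAV, Lemma 5.2 (3)] [cite: Markman2025SurveySecant, §11.5 Step 1]
[cite: MumfordAV1970, §7 Thm. 4 p. 72] -/
theorem weilAlgebraicNonsplitHyperplane_sq_mul (H : HyperplanePullbackAlongIsogeny) {n m d : ℕ}
    (hm : m ≠ 0) (hW : WeilAlgebraicNonsplitHyperplane n d) :
    WeilAlgebraicNonsplitHyperplane n (m ^ 2 * d) := by
  rcases Nat.eq_zero_or_pos d with rfl | hd
  · simpa using hW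
  intro A φ' hA hφ' hnon c' hc'W hrat hhodge
  obtain ⟨B, p, f, ψ, hp, -, hf, -, hψ, hfφ, hpψ⟩ := exists_isogeny_sq_descent' hm hφ'
  have hB : B.dim = 2 * n := (AbelianVariety.dim_eq_of_isIsogenous_holds ⟨p, hp⟩).symm.trans hA
  have hnonB : ∀ (e' : ProjectiveEmbedding B.X) (a' : complexBetti (projectiveSpace e'.n ℂ) 2),
      IsRationalClass a' → a' ≠ 0 →
        ¬ IsHyperbolicWeilType B ψ n ((d : ℂ) • complexBetti.map e'.ι 2 a' +
          complexBetti.map ψ.hom.hom.hom 2 (complexBetti.map e'.ι 2 a')) := by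
    intro e' a' ha' ha'0 hB₁
    -- `(B, mψ, m²d)` is hyperbolic for `m²d·y' + (mψ)^*y'`
    have hB₂ : IsHyperbolicWeilType B ((m : ℤ) • ψ) n (((m ^ 2 * d : ℕ) : ℂ) • complexBetti.map e'.ι 2 a' +
        complexBetti.map ((m : ℤ) • ψ).hom.hom.hom 2 (complexBetti.map e'.ι 2 a')) := by
      rw [symmetrised_natCast_zsmul,
        isHyperbolicWeilType_smul_iff (pow_ne_zero 2 (Nat.cast_ne_zero.mpr hm)),
        isHyperbolicWeilType_natCast_zsmul_iff hm]
      exact hB₁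
    -- transport to `A` along `p`
    have hA₁ := (isHyperbolicWeilType_iff_of_isIsogeny hp hpψ).1 hB₂
    rw [map_symmetrised_of_comm p hpψ] at hA₁
    -- the hyperplane class `e''^*a'' = c·p^*y'` of `A`
    obtain ⟨e'', a'', c, ha'', ha''0, hc, he''⟩ := H B A p hp e' a' ha' ha'0
    refine hnon e'' a'' ha'' ha''0 ?_
    rw [he'', map_smul, smul_comm (((m ^ 2 * d : ℕ) : ℂ)) (c : ℂ), ← smul_add]
    exact (isHyperbolicWeilType_smul_iff (by exact_mod_cast hc)).2 hA₁
  exact weilAlgebraicFor_of_descent hm hd.ne' hA hp hf hψ hfφ (hW B ψ hB hψ hnonB) c' hc'W hrat hhodge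

/-- **Squarefree `d` suffice on the non-split slices, modulo the print obligation.**
[cite: MoonenZarhin1998WeilClasses, §1] -/
theorem forall_weilAlgebraicNonsplitHyperplane_iff_squarefree (H : HyperplanePullbackAlongIsogeny) (n : ℕ) :
    (∀ d : ℕ, 0 < d → WeilAlgebraicNonsplitHyperplane n d) ↔
      ∀ d : ℕ, 0 < d → Squarefree d → WeilAlgebraicNonsplitHyperplane n d := by
  refine ⟨fun h d hd _ => h d hd, fun h d hd => ?_⟩
  obtain ⟨a, b, ha, hb, rfl, hsq⟩ := Nat.sq_mul_squarefree_of_pos hd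
  exact weilAlgebraicNonsplitHyperplane_sq_mul H hb.ne' (h a ha hsq)

/-- **R1′ re-indexed: `NonsplitSixfolds ↔` its squarefree slices**, modulo the print obligation. OPEN
on both sides ("outside this locus, the Hodge conjecture for Weil classes on sixfolds remains completely
open", arXiv:2603.20268 p. 3); no case of HC is claimed. [cite: Markman2025SurveySecant, §11.5 Step 1 and §12]
[cite: MoonenZarhin1998WeilClasses, §1] -/
theorem nonsplitSixfolds_iff_squarefree (H : HyperplanePullbackAlongIsogeny) :
    NonsplitSixfolds ↔ ∀ d : ℕ, 0 < d → Squarefree d → WeilAlgebraicNonsplitHyperplane 3 d := by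
  rw [nonsplitSixfolds_iff_forall_nonsplitHyperplane,
    forall_weilAlgebraicNonsplitHyperplane_iff_squarefree H]

/-- The non-split square class, both ways (down free, up modulo the obligation). [cite: MoonenZarhin1998WeilClasses, §1] -/
theorem weilAlgebraicNonsplitHyperplane_sq_class_iff (H : HyperplanePullbackAlongIsogeny) {n m d : ℕ}
    (hm : m ≠ 0) :
    WeilAlgebraicNonsplitHyperplane n (m ^ 2 * d) ↔ WeilAlgebraicNonsplitHyperplane n d :=
  ⟨weilAlgebraicNonsplitHyperplane_of_sq_mul hm, weilAlgebraicNonsplitHyperplane_sq_mul H hm⟩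

/-! ### On-path: every slice is a case of the summit -/

/-- Every split slice is a case of the summit (`HodgeConjecture → WeilAlgebraicSplitHyperplane n d`).
[cite: Deligne2000, §1] -/
theorem weilAlgebraicSplitHyperplane_of_hodgeConjecture (h : _root_.HodgeConjecture) (n d : ℕ) :
    Stubs.WeilAlgebraicSplitHyperplane n d :=
  fun _ _ _ _ hA _ _ _ _ c _ hc hnn => (h (isSmoothProjective_of_dim_eq' hA)).2 n c hc hnn

/-- Every non-split slice is a case of the summit. [cite: Deligne2000, §1] -/
theorem weilAlgebraicNonsplitHyperplane_of_hodgeConjecture (h : _root_.HodgeConjecture) (n d : ℕ) :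
    WeilAlgebraicNonsplitHyperplane n d :=
  fun _ _ hA _ _ c _ hc hnn => (h (isSmoothProjective_of_dim_eq' hA)).2 n c hc hnn

/-- The print obligation is NOT a case of the summit and is not claimed; recorded: under it, the four
hyperbolic / non-split rungs of `WeilTypeLadder` are statements about squarefree `d` only. [folklore] -/
theorem hyperbolicRungs_iff_squarefree (H : HyperplanePullbackAlongIsogeny) :
    (SplitEightfolds ↔ ∀ d : ℕ, 0 < d → Squarefree d → Stubs.WeilAlgebraicSplitHyperplane 4 d) ∧
      (SplitWeilAbelianVarieties ↔
        ∀ n : ℕ, 4 ≤ n → ∀ d : ℕ, 0 < d → Squarefree d → Stubs.WeilAlgebraicSplitHyperplane n d) ∧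
      (Markman2025_weilClasses_algebraic_hyperbolicSixfold ↔
        ∀ d : ℕ, 0 < d → Squarefree d → Stubs.WeilAlgebraicSplitHyperplane 3 d) ∧
      (NonsplitSixfolds ↔ ∀ d : ℕ, 0 < d → Squarefree d → WeilAlgebraicNonsplitHyperplane 3 d) :=
  ⟨splitEightfolds_iff_squarefree H, splitWeilAbelianVarieties_iff_squarefree H,
    markmanHyperbolicSixfold_iff_squarefree H, nonsplitSixfolds_iff_squarefree H⟩

end Summit.HodgeConjecture.HodgeConjecture.Ring2.AbelianAll

end
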